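import Summits.BirchSwinnertonDyer.BirchSwinnertonDyer.Theorems.PrintCFramBottomClassIndexLawFiveLeCohenCutDictionary
import Summits.BirchSwinnertonDyer.BirchSwinnertonDyer.Theorems.PrintCFramBottomClassIndexLawFiveLeHeegnerFieldSupplySeedOn
import Summits.BirchSwinnertonDyer.BirchSwinnertonDyer.Theorems.PrintCFramBottomClassIndexLawFiveLeHeegnerFieldSupplyReflection
import Literature.NumberTheory.Congruences.BernoulliCharacterTeichmullerCongruenceRamified
import Literature.NumberTheory.EllipticCurves.KrizLi2019.TeichmullerCharacterExists
import Summits.BirchSwinnertonDyer.BirchSwinnertonDyer.Theorems.PrintCFramBottomClassIndexLawFiveLeThetaCycleLegendreDescent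
import HarnessLib

/-!
# Crux `PrintCFram.BottomClassIndexLawFiveLe` (stmt-BirchSwinnertonDyer-20372), line `eisenstein-resource-bdp-line` (registry v23):
# THE COHEN DICTIONARY ON THE `m`-CUT, part 2 — `p`-INTEGRALITY of `k⁻¹ B_k((χ↑ε_K↑)~)` on the whole cut (both branches
# `p ∤ n₀` and `p ∣ n₀`) and the dictionary conjunct of `stub_cutForm` in its `∃ t x` form
# (cell `bsd-print-cfram`, width seat `bsd-line-cfram-p1-w4` g12; THEOREMS ONLY, `--supports` 20372; BSD is not proved by any of this)

HONEST FRAMING. Nothing here is a statement about BSD or about any curve; no registered stub is closed. The dictionary conjunct of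
registry v23's `stub_cutForm` (= (CutForm⁶), `hcut` of `ThetaCycle.atP_six_of_cutForm`) asks, at every cut index `a = m·n₀·f²`, for
`t : ℤ` and `x : ℤ_[p]` with `t = 1` at `f = 1`, `↑x = k⁻¹ B_k((χ↑ε_K↑)~)` and `coeff a G = t · ι x`. The companion file
`…CohenCutDictionary` proved `(H(k, a) : ℚ_p) = −T · (k⁻¹ B_k((χ↑ε_K↑)~))`; here we prove that `k⁻¹ B_k((χ↑ε_K↑)~)` IS a `p`-adic
integer for the class data (`p ∤ m`, `p ≡ 3 (mod 4)`, `p ≥ 7`, `k ∈ {(p+1)/4, (3p−1)/4}`) — the integrality half of item (D3) of the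
typing memo (`Lines/eisenstein-resource-bdp-line-w8g6-notes.md` §3.1):
* `p ∤ n₀`: the conductor `m n₀` is prime to `p` — `CharacterTwist.norm_generalizedBernoulli_div_le_one` (Lang Ch. 2 Thms 2.4–2.5);
* `p ∣ n₀` (the `p`-ramified fields `K`, e.g. the CM field `ℚ(√−p)` itself): `χ_{D'} = (χ·J(·|n₁))·J(·|p)` with `n₀ = p n₁` and
  `J(·|p) = ω^{(p−1)/2}` (Euler's criterion on the Teichmüller lift, `HeegnerFieldSupply.jacobiSym_eq_teichmuller_pow_half`), so the
  RAMIFIED branch `CharacterTwist.norm_generalizedBernoulli_div_le_one_ramified` applies with `a = (p−1)/2`; its exponent condition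
  `(p−1) ∤ (p−1)/2 + k` holds exactly because `k ∈ {(p+1)/4, (3p−1)/4}` (w8 g5's `HeegnerFieldSupply.not_dvd_half_add_classExponent`).
Results: `norm_bernoulliDisc_div_le_one_of_dvd` / `_of_not_dvd` / `norm_bernoulliDisc_div_le_one`
(`K`-free, `bernoulliDisc` currency), `norm_lValueDisc_le_one`, **`norm_bernoulli_cut_le_one`** (the stub's `B_k((χ↑ε_K↑)~)`),
`exists_padicInt_bernoulli_cut`; §2b `exists_eq_mul_sq_of_cut` (a cut index is `m n₀ f²`), **`norm_ratCast_cohenH_cut_le_one`**,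
**`exists_padicInt_eq_cohenH_of_cut`** (`H(k, a) ∈ ℤ_p` at EVERY cut index — what the glue needs to reduce the cut series mod `p`);
the packaged **`exists_dictionary_cut`**:
`∃ (t : ℤ) (x : ℤ_[p]), (f = 1 → t = 1) ∧ ↑x = k⁻¹ B_k((χ↑ε_K↑)~) ∧ (H(k, m n₀ f²) : ℚ_p) = −(t · x)`; and §4 **`cutForm_dictionary_of_coeff`** —
the dictionary clause of `stub_cutForm` in its VERBATIM shape for ANY `G` with `coeff a G = ι(−y_a)`, `↑y_a = H(k, a)` on the cut.
beyond-print theorem: NO.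

References: [Cohen1975] §2; [LangCyclotomic1990] Ch. 2 §2, Thms 2.4–2.5; [Washington1997] §5.1, Thm. 5.11, Cor. 5.13;
[IrelandRosen1990] Prop. 5.1.2; crux notes `Lines/eisenstein-resource-bdp-line-w8g6-notes.md` §3.1 (D3).
-/

set_option autoImplicit false
-- summit-side namespace `Summit.BirchSwinnertonDyer.BirchSwinnertonDyer.…` (single-conjunct summit, D-0017 layout)
set_option linter.dupNamespace false

noncomputable section

open scoped Classical NumberTheorySymbols
open NumberField DirichletCharacter
open Literature.NumberTheory.LFunctions Literature.NumberTheory.ModularForms.CohenEisenstein Literature.NumberTheory.EllipticCurves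
  Literature.NumberTheory.EllipticCurves.KrizLi2019 Literature.NumberTheory.Congruences

namespace Summit.BirchSwinnertonDyer.BirchSwinnertonDyer.Theorems.PrintCFram.CohenCut

open Summit.BirchSwinnertonDyer.BirchSwinnertonDyer.Theorems.PrintCFram

variable {p : ℕ} [hp : Fact p.Prime]

/-! ## §1 The exponent condition of the ramified branch

For `p ≡ 3 (mod 4)`, `p ≥ 7`, `k ∈ {(p+1)/4, (3p−1)/4}`: `(p − 1) ∤ (p−1)/2 + k` — this is w8 g5's
`HeegnerFieldSupply.not_dvd_half_add_classExponent` (`…HeegnerFieldSupplyReflection`), imported, not restated. -/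

/-! ## §2 `p`-integrality of `k⁻¹ B_k((χ↑ε_K↑)~)` -/

section Integrality

variable {m : ℕ} [NeZero m] {χ : DirichletCharacter ℚ_[p] m} {k n₀ : ℕ} {K : Type} [Field K] [NumberField K]
  {εK : DirichletCharacter ℚ_[p] (NumberField.discr K).natAbs}

omit [NeZero m] in
/-- Values of a triple product `(χ↑·κ↑)↑·λ↑` at a natural number prime to the level: the product of the values. [folklore] -/
private theorem triple_apply {n₁ : ℕ} [NeZero (m * n₁)] [NeZero n₁] (κ : DirichletCharacter ℚ_[p] n₁)
    (lam : DirichletCharacter ℚ_[p] p) {c : ℕ} (hc : c.Coprime (m * n₁ * p)) :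
    (changeLevel (dvd_mul_right (m * n₁) p) (changeLevel (dvd_mul_right m n₁) χ * changeLevel (dvd_mul_left n₁ m) κ) *
        changeLevel (dvd_mul_left p (m * n₁)) lam) (c : ZMod (m * n₁ * p)) =
      χ (c : ZMod m) * κ (c : ZMod n₁) * lam (c : ZMod p) := by
  have hc1 : IsCoprime (c : ℤ) ((m * n₁ * p : ℕ) : ℤ) := Nat.isCoprime_iff_coprime.mpr hc
  have hc2 : IsCoprime (c : ℤ) ((m * n₁ : ℕ) : ℤ) := Nat.isCoprime_iff_coprime.mpr (Nat.Coprime.coprime_mul_right_right hc)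
  rw [MulChar.mul_apply]
  have h1 := changeLevel_eq_cast_of_dvd' (changeLevel (dvd_mul_right m n₁) χ * changeLevel (dvd_mul_left n₁ m) κ)
    (dvd_mul_right (m * n₁) p) hc1
  have h2 := changeLevel_eq_cast_of_dvd' lam (dvd_mul_left p (m * n₁)) hc1
  have h3 := changeLevel_eq_cast_of_dvd' χ (dvd_mul_right m n₁) hc2
  have h4 := changeLevel_eq_cast_of_dvd' κ (dvd_mul_left n₁ m) hc2
  simp only [Int.cast_natCast] at h1 h2 h3 h4
  rw [h1, h2, MulChar.mul_apply, h3, h4]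

/-- **The RAMIFIED branch `p ∣ n₀`**: `‖k⁻¹ · bernoulliDisc k (e*·(−n₀))‖_p ≤ 1`, read through the character
`(χ·J(·|n₁))↑ · (ω^{(p−1)/2})↑` of level `(m n₁)·p` (`n₀ = p·n₁`), whose values are `χ_{e*·(−n₀)}` since `J(·|p) = ω^{(p−1)/2}`.
[cite: LangCyclotomic1990, Ch. 2 §2, Thm. 2.4 and the proof of Thm. 2.5] [cite: Washington1997, Thm. 5.11 and Cor. 5.13] -/
theorem norm_bernoulliDisc_div_le_one_of_dvd (hp4 : p % 4 = 3) (h7 : 7 ≤ p) (hmp : m.Coprime p) (hχ : χ.IsPrimitive)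
    (hχq : χ.IsQuadratic) {s : ℤ} (hs : χ (-1) = (s : ℚ_[p])) (hs1 : s = 1 ∨ s = -1)
    (hk : k = (p + 1) / 4 ∨ k = (3 * p - 1) / 4) (hsq : Squarefree n₀) (h4 : n₀ % 4 = 3) (hpn : p ∣ n₀) :
    ‖(k : ℚ_[p])⁻¹ * algebraMap ℚ ℚ_[p] (bernoulliDisc k (s * m * -(n₀ : ℤ)))‖ ≤ 1 := by
  have hp2 : p ≠ 2 := by omega
  obtain ⟨n₁, hn₁⟩ := hpn
  have hn₁0 : n₁ ≠ 0 := by rintro rfl; rw [mul_zero] at hn₁; rw [hn₁] at h4; norm_num at h4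
  haveI : NeZero n₁ := ⟨hn₁0⟩
  haveI : NeZero (m * n₁) := ⟨mul_ne_zero (NeZero.ne m) hn₁0⟩
  haveI : NeZero (m * n₁ * p) := ⟨mul_ne_zero (NeZero.ne (m * n₁)) hp.out.ne_zero⟩
  have hpn₁ : ¬ p ∣ n₁ := by
    rintro ⟨t, rfl⟩
    exact Nat.squarefree_iff_prime_squarefree.mp hsq p hp.out ⟨t, by rw [hn₁]; ring⟩
  have hN : (m * n₁).Coprime p := Nat.Coprime.mul_left hmp (Nat.coprime_comm.mp ((hp.out.coprime_iff_not_dvd).mpr hpn₁))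
  -- the characters: `κ₁ = J(· | n₁)` mod `n₁`, `ω` Teichmüller, exponent `a = (p−1)/2`
  obtain ⟨κ₁, hκ₁⟩ := KrizLiBinders.exists_jacobiCharPadic (p := p) n₁
  obtain ⟨ω, hω⟩ := exists_isTeichmullerCharacter (p := p)
  have ha : 1 ≤ (p - 1) / 2 := by omega
  have ha0 : (p - 1) / 2 ≠ 0 := by omega
  have hk1 : 1 ≤ k := by rcases hk with rfl | rfl <;> omega
  have hbound := CharacterTwist.norm_generalizedBernoulli_div_le_one_ramified hN
    (changeLevel (dvd_mul_right m n₁) χ * changeLevel (dvd_mul_left n₁ m) κ₁) ω hω ha hk1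
    (HeegnerFieldSupply.not_dvd_half_add_classExponent hp4 h7 hk)
  -- the values of the level-`(m n₁) p` character are `χ_{e*·(−n₀)}`
  obtain ⟨he, hs0⟩ := sign_mul_emod_four hχ hχq hs hs1
  have hlev : m * n₁ * p = (s * m * -(n₀ : ℤ)).natAbs := by
    rw [Int.natAbs_mul, Int.natAbs_neg, Int.natAbs_natCast, hn₁, show (s * m : ℤ).natAbs = m by
      rcases hs1 with rfl | rfl <;> simp]
    ring
  have hval : ∀ c : ℕ,
      (changeLevel (dvd_mul_right (m * n₁) p) (changeLevel (dvd_mul_right m n₁) χ * changeLevel (dvd_mul_left n₁ m) κ₁) *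
          changeLevel (dvd_mul_left p (m * n₁)) (ω ^ ((p - 1) / 2))) (c : ZMod (m * n₁ * p)) =
        (chiDisc (s * m * -(n₀ : ℤ)) c : ℚ_[p]) := by
    intro c
    by_cases hc : c.Coprime (m * n₁ * p)
    · rw [triple_apply κ₁ (ω ^ ((p - 1) / 2)) hc, MulChar.pow_apply' ω ha0, ← HeegnerFieldSupply.jacobiSym_eq_teichmuller_pow_half
        hω hp2 c, hκ₁ c, apply_natCast_eq_chiDisc hχ hχq hs hs1 c, mul_assoc, ← Int.cast_mul, ← jacobiSym.mul_right,
        show n₁ * p = n₀ by rw [hn₁, mul_comm], ← Int.cast_mul, chiDisc_mul_jacobiSym he hs0 h4 c]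
    · rw [MulChar.map_nonunit _ (by rwa [ZMod.isUnit_iff_coprime]), eq_comm, ← Int.cast_zero, Int.cast_inj]
      have hD : (s * m * -(n₀ : ℤ)) % 4 = 1 ∨ 4 ∣ (s * m * -(n₀ : ℤ)) := by
        rcases he with he | he
        · left; rw [Int.mul_emod, he]; omega
        · exact Or.inr (dvd_mul_of_dvd_left he _)
      exact chiDisc_eq_zero_of_not_coprime hD (by rwa [← hlev])
  rw [algebraMap_bernoulliDisc_eq k hlev _ hval]
  exact hbound

/-- **The UNRAMIFIED branch `p ∤ n₀`**: `‖k⁻¹ · bernoulliDisc k (e*·(−n₀))‖_p ≤ 1`, read through the character `χ↑·J(·|n₀)↑` of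
level `m n₀` prime to `p` (`2 ≤ k ≤ p − 2`). [cite: LangCyclotomic1990, Ch. 2 §2, Thm. 2.4 and the proof of Thm. 2.5] -/
theorem norm_bernoulliDisc_div_le_one_of_not_dvd (hmp : m.Coprime p) (hχ : χ.IsPrimitive) (hχq : χ.IsQuadratic) {s : ℤ}
    (hs : χ (-1) = (s : ℚ_[p])) (hs1 : s = 1 ∨ s = -1) (h2k : 2 ≤ k) (hkp : k ≤ p - 2) (hsq : Squarefree n₀) (h4 : n₀ % 4 = 3)
    (hpn : ¬ p ∣ n₀) : ‖(k : ℚ_[p])⁻¹ * algebraMap ℚ ℚ_[p] (bernoulliDisc k (s * m * -(n₀ : ℤ)))‖ ≤ 1 := by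
  haveI : NeZero n₀ := ⟨hsq.ne_zero⟩
  haveI : NeZero (m * n₀) := ⟨mul_ne_zero (NeZero.ne m) hsq.ne_zero⟩
  obtain ⟨κ, hκ⟩ := KrizLiBinders.exists_jacobiCharPadic (p := p) n₀
  have hN : (m * n₀).Coprime p := Nat.Coprime.mul_left hmp (Nat.coprime_comm.mp ((hp.out.coprime_iff_not_dvd).mpr hpn))
  obtain ⟨he, hs0⟩ := sign_mul_emod_four hχ hχq hs hs1
  have hlev : m * n₀ = (s * m * -(n₀ : ℤ)).natAbs := by
    rw [Int.natAbs_mul, Int.natAbs_neg, Int.natAbs_natCast, show (s * m : ℤ).natAbs = m by rcases hs1 with rfl | rfl <;> simp]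
  have hval : ∀ c : ℕ, (changeLevel (dvd_mul_right m n₀) χ * changeLevel (dvd_mul_left n₀ m) κ) (c : ZMod (m * n₀)) =
      (chiDisc (s * m * -(n₀ : ℤ)) c : ℚ_[p]) := by
    intro c
    by_cases hc : c.Coprime (m * n₀)
    · have hcI : IsCoprime (c : ℤ) ((m * n₀ : ℕ) : ℤ) := Nat.isCoprime_iff_coprime.mpr hc
      have h1 := changeLevel_eq_cast_of_dvd' χ (dvd_mul_right m n₀) hcI
      have h2 := changeLevel_eq_cast_of_dvd' κ (dvd_mul_left n₀ m) hcI
      simp only [Int.cast_natCast] at h1 h2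
      rw [MulChar.mul_apply, h1, h2, hκ c, apply_natCast_eq_chiDisc hχ hχq hs hs1 c, ← Int.cast_mul,
        chiDisc_mul_jacobiSym he hs0 h4 c]
    · rw [MulChar.map_nonunit _ (by rwa [ZMod.isUnit_iff_coprime]), eq_comm, ← Int.cast_zero, Int.cast_inj]
      have hD : (s * m * -(n₀ : ℤ)) % 4 = 1 ∨ 4 ∣ (s * m * -(n₀ : ℤ)) := by
        rcases he with he | he
        · left; rw [Int.mul_emod, he]; omega
        · exact Or.inr (dvd_mul_of_dvd_left he _)
      exact chiDisc_eq_zero_of_not_coprime hD (by rwa [← hlev])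
  rw [algebraMap_bernoulliDisc_eq k hlev _ hval]
  exact CharacterTwist.norm_generalizedBernoulli_div_le_one hN _ h2k hkp

/-- **`k⁻¹ · B_{k,χ_{D'}}` is a `p`-adic integer, `D' = χ(−1)·m·(−n₀)`, on the WHOLE cut** (both `p ∤ n₀` and `p ∣ n₀`), for the
class data `p ≡ 3 (mod 4)`, `p ≥ 7`, `p ∤ m`, `k ∈ {(p+1)/4, (3p−1)/4}` — in the `K`-free `bernoulliDisc` currency.
[cite: LangCyclotomic1990, Ch. 2 §2, Thm. 2.4 and the proof of Thm. 2.5] [cite: Washington1997, Thm. 5.11 and Cor. 5.13] -/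
theorem norm_bernoulliDisc_div_le_one (hp4 : p % 4 = 3) (h7 : 7 ≤ p) (hmp : m.Coprime p) (hχ : χ.IsPrimitive)
    (hχq : χ.IsQuadratic) {s : ℤ} (hs : χ (-1) = (s : ℚ_[p])) (hs1 : s = 1 ∨ s = -1)
    (hk : k = (p + 1) / 4 ∨ k = (3 * p - 1) / 4) (hsq : Squarefree n₀) (h4 : n₀ % 4 = 3) :
    ‖(k : ℚ_[p])⁻¹ * algebraMap ℚ ℚ_[p] (bernoulliDisc k (s * m * -(n₀ : ℤ)))‖ ≤ 1 := by
  by_cases hpn : p ∣ n₀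
  · exact norm_bernoulliDisc_div_le_one_of_dvd hp4 h7 hmp hχ hχq hs hs1 hk hsq h4 hpn
  · have h2k : 2 ≤ k := by rcases hk with rfl | rfl <;> omega
    have hkp : k ≤ p - 2 := by rcases hk with rfl | rfl <;> omega
    exact norm_bernoulliDisc_div_le_one_of_not_dvd hmp hχ hχq hs hs1 h2k hkp hsq h4 hpn

/-- **`L(1 − k, χ_{D'}) = −B_{k,χ_{D'}}/k` is a `p`-adic integer** on the whole cut (same hypotheses).
[cite: LangCyclotomic1990, Ch. 2 §2, Thm. 2.4 and the proof of Thm. 2.5] [cite: Washington1997, Thm. 5.11 and Cor. 5.13] -/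
theorem norm_lValueDisc_le_one (hp4 : p % 4 = 3) (h7 : 7 ≤ p) (hmp : m.Coprime p) (hχ : χ.IsPrimitive)
    (hχq : χ.IsQuadratic) {s : ℤ} (hs : χ (-1) = (s : ℚ_[p])) (hs1 : s = 1 ∨ s = -1)
    (hk : k = (p + 1) / 4 ∨ k = (3 * p - 1) / 4) (hsq : Squarefree n₀) (h4 : n₀ % 4 = 3) :
    ‖((lValueDisc k (s * m * -(n₀ : ℤ)) : ℚ) : ℚ_[p])‖ ≤ 1 := by
  have h := norm_bernoulliDisc_div_le_one hp4 h7 hmp hχ hχq hs hs1 hk hsq h4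
  rw [lValueDisc, Rat.cast_div, Rat.cast_neg, Rat.cast_natCast, ← eq_ratCast (algebraMap ℚ ℚ_[p]), neg_div, norm_neg,
    div_eq_inv_mul]
  exact h

/-- **`k⁻¹ · B_k((χ↑ε_K↑)~)` IS A `p`-ADIC INTEGER** for the class data (`p ≡ 3 (mod 4)`, `p ≥ 7`, `p ∤ m`, `χ` primitive quadratic
mod `m`, `k ∈ {(p+1)/4, (3p−1)/4}`) at every field `K = ℚ(√−n₀)` of the cut (`n₀ ≡ 3 (mod 4)` squarefree, prime to `m`), BOTH for
`p ∤ n₀` (conductor prime to `p`) and for `p ∣ n₀` (ramified branch, `norm_bernoulliDisc_div_le_one_of_dvd`).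
[cite: LangCyclotomic1990, Ch. 2 §2, Thm. 2.4 and the proof of Thm. 2.5] [cite: Washington1997, Thm. 5.11 and Cor. 5.13] -/
theorem norm_bernoulli_cut_le_one (hp4 : p % 4 = 3) (h7 : 7 ≤ p) (hmp : m.Coprime p) (hχ : χ.IsPrimitive) (hχq : χ.IsQuadratic)
    (hk : k = (p + 1) / 4 ∨ k = (3 * p - 1) / 4) (hK : IsImaginaryQuadratic K) (hsq : Squarefree n₀) (h4 : n₀ % 4 = 3)
    (hdisc : NumberField.discr K = -(n₀ : ℤ)) (hεK : IsKroneckerCharacterOf K εK) (hcop : m.Coprime n₀) :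
    ‖(k : ℚ_[p])⁻¹ * @generalizedBernoulli ℚ_[p] _ _
        (changeLevel (dvd_mul_right m (NumberField.discr K).natAbs) χ *
          changeLevel (dvd_mul_left (NumberField.discr K).natAbs m) εK).conductor ⟨conductor_ne_zero _⟩ k
        (changeLevel (dvd_mul_right m (NumberField.discr K).natAbs) χ *
          changeLevel (dvd_mul_left (NumberField.discr K).natAbs m) εK).primitiveCharacter‖ ≤ 1 := by
  obtain ⟨s, hs1', hs⟩ := PrimitiveQuadratic.exists_sign_eq_of_charZero χ
  have hs1 : s = 1 ∨ s = -1 := by rcases hs1' with ⟨h, -⟩ | ⟨h, -⟩ <;> simp [h]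
  rw [generalizedBernoulli_primitiveCharacter_mul_eq hχ hχq hs hs1 hK.1 hsq h4 hdisc hεK hcop k]
  exact norm_bernoulliDisc_div_le_one hp4 h7 hmp hχ hχq hs hs1 hk hsq h4

/-- **The `x : ℤ_[p]` of the dictionary**: `∃ x : ℤ_[p], ↑x = k⁻¹ · B_k((χ↑ε_K↑)~)`.
[cite: LangCyclotomic1990, Ch. 2 §2, Thm. 2.4 and the proof of Thm. 2.5] -/
theorem exists_padicInt_bernoulli_cut (hp4 : p % 4 = 3) (h7 : 7 ≤ p) (hmp : m.Coprime p) (hχ : χ.IsPrimitive)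
    (hχq : χ.IsQuadratic) (hk : k = (p + 1) / 4 ∨ k = (3 * p - 1) / 4) (hK : IsImaginaryQuadratic K) (hsq : Squarefree n₀)
    (h4 : n₀ % 4 = 3) (hdisc : NumberField.discr K = -(n₀ : ℤ)) (hεK : IsKroneckerCharacterOf K εK) (hcop : m.Coprime n₀) :
    ∃ x : ℤ_[p], (x : ℚ_[p]) = (k : ℚ_[p])⁻¹ * @generalizedBernoulli ℚ_[p] _ _
        (changeLevel (dvd_mul_right m (NumberField.discr K).natAbs) χ *
          changeLevel (dvd_mul_left (NumberField.discr K).natAbs m) εK).conductor ⟨conductor_ne_zero _⟩ k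
        (changeLevel (dvd_mul_right m (NumberField.discr K).natAbs) χ *
          changeLevel (dvd_mul_left (NumberField.discr K).natAbs m) εK).primitiveCharacter :=
  ⟨⟨_, norm_bernoulli_cut_le_one hp4 h7 hmp hχ hχq hk hK hsq h4 hdisc hεK hcop⟩, rfl⟩

end Integrality

/-! ## §2b `p`-integrality of `H(k, a)` on the whole cut (no `K`, no `ε_K`) -/

section CutIntegrality

variable {m : ℕ} [NeZero m] {χ : DirichletCharacter ℚ_[p] m} {k : ℕ}

omit [NeZero m] in
/-- A cut index decomposes: `m ∣ a`, `a/m ≡ 3 (mod 4)` ⟹ `a = m·(n₀·f²)` with `n₀ ≡ 3 (mod 4)` squarefree and `f ≥ 1`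
(`f` is odd, so `n₀ ≡ a/m (mod 8)`). [cite: Cohen1975, §2 (definition of H(r, N))] -/
theorem exists_eq_mul_sq_of_cut {a : ℕ} (hma : m ∣ a) (h4 : a / m % 4 = 3) :
    ∃ n₀ f : ℕ, Squarefree n₀ ∧ n₀ % 4 = 3 ∧ 0 < f ∧ a = m * (n₀ * f ^ 2) ∧ a / m = n₀ * f ^ 2 := by
  obtain ⟨n', hn'⟩ := hma
  have hm0 : 0 < m := Nat.pos_of_ne_zero fun h => by rw [h, zero_mul] at hn'; rw [hn', Nat.zero_div] at h4; norm_num at h4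
  have hdiv : a / m = n' := by rw [hn', Nat.mul_div_cancel_left _ hm0]
  rw [hdiv] at h4
  have hn0 : 0 < n' := by omega
  obtain ⟨n₀, f, -, hf, hfn, hsq⟩ := Nat.sq_mul_squarefree_of_pos hn0
  have hmod := ThetaCycle.mod_four_of_sq_mul (f := f) (n₁ := n₀) (by rw [hfn]; exact h4)
  refine ⟨n₀, f, hsq, hmod.2.1, hf, ?_, ?_⟩
  · rw [hn', ← hfn]; ring
  · rw [hdiv, ← hfn]; ring

/-- **`H(k, a)` IS A `p`-ADIC INTEGER AT EVERY CUT INDEX `a = m·n₀·f²`** (class data as above; `n₀ ≡ 3 (mod 4)` squarefree, `f ≥ 1`,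
the cut's Jacobi clauses): `‖(H(k, m n₀ f²) : ℚ_p)‖ ≤ 1` — `H = L(1−k, χ_{D'})·T` with `T ∈ ℤ` and `L(1−k, χ_{D'})` integral.
[cite: Cohen1975, §2 (definition of H(r, N))] [cite: LangCyclotomic1990, Ch. 2 §2, Thm. 2.4 and the proof of Thm. 2.5] -/
theorem norm_ratCast_cohenH_cut_le_one {n₀ f : ℕ} (hp4 : p % 4 = 3) (h7 : 7 ≤ p) (hmp : m.Coprime p) (hχ : χ.IsPrimitive)
    (hχq : χ.IsQuadratic) (hk : k = (p + 1) / 4 ∨ k = (3 * p - 1) / 4) (hpar : χ (-1) * (-1) ^ k = -1)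
    (hsq : Squarefree n₀) (h4 : n₀ % 4 = 3) (hf : 0 < f)
    (hJ : ∀ q : ℕ, q.Prime → q ∣ m → q ≠ 2 → jacobiSym (-((n₀ * f ^ 2 : ℕ) : ℤ)) q = 1) :
    ‖((cohenH k (m * (n₀ * f ^ 2)) : ℚ) : ℚ_[p])‖ ≤ 1 := by
  obtain ⟨s, hs1', hs⟩ := PrimitiveQuadratic.exists_sign_eq_of_charZero χ
  have hs1 : s = 1 ∨ s = -1 := by rcases hs1' with ⟨h, -⟩ | ⟨h, -⟩ <;> simp [h]
  rw [cohenH_cut_eq hχ hχq hs hs1 hpar hsq h4 hf hJ, Rat.cast_mul, Rat.cast_intCast, norm_mul]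
  exact mul_le_one₀ (norm_lValueDisc_le_one hp4 h7 hmp hχ hχq hs hs1 hk hsq h4) (norm_nonneg _) (Padic.norm_int_le_one _)

/-- **`H(k, a) ∈ ℤ_p` at every index of the `m`-cut** — the form the glue needs to REDUCE the cut Cohen series mod `p`: for
`m ∣ a`, `a/m ≡ 3 (mod 4)` and the Jacobi clauses `J(−(a/m) | q) = 1` at the odd primes `q ∣ m`, there is `y : ℤ_[p]` with
`↑y = (H(k, a) : ℚ_p)`. (Decompose `a = m n₀ f²` by `exists_eq_mul_sq_of_cut`.) [cite: Cohen1975, §2 (definition of H(r, N))] -/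
theorem exists_padicInt_eq_cohenH_of_cut {a : ℕ} (hp4 : p % 4 = 3) (h7 : 7 ≤ p) (hmp : m.Coprime p) (hχ : χ.IsPrimitive)
    (hχq : χ.IsQuadratic) (hk : k = (p + 1) / 4 ∨ k = (3 * p - 1) / 4) (hpar : χ (-1) * (-1) ^ k = -1) (hma : m ∣ a)
    (ha4 : a / m % 4 = 3) (hJ : ∀ q : ℕ, q.Prime → q ∣ m → q ≠ 2 → jacobiSym (-((a / m : ℕ) : ℤ)) q = 1) :
    ∃ y : ℤ_[p], (y : ℚ_[p]) = ((cohenH k a : ℚ) : ℚ_[p]) := by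
  obtain ⟨n₀, f, hsq, h4, hf, rfl, hdiv⟩ := exists_eq_mul_sq_of_cut hma ha4
  rw [hdiv] at hJ
  exact ⟨⟨_, norm_ratCast_cohenH_cut_le_one hp4 h7 hmp hχ hχq hk hpar hsq h4 hf hJ⟩, rfl⟩

end CutIntegrality

/-! ## §3 The dictionary conjunct of `stub_cutForm`, packaged -/

/-- **THE DICTIONARY CONJUNCT OF (CutForm⁶) FOR THE COHEN NUMBERS**: for a class datum (`p ≡ 3 (mod 4)`, `p ≥ 7`, `p ∤ m`,
`χ` primitive quadratic mod `m` with the parity clause `χ(−1)(−1)^k = −1`, `k ∈ {(p+1)/4, (3p−1)/4}`), a cut index `m·n₀·f²`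
(`n₀ ≡ 3 (mod 4)` squarefree, `f ≥ 1`, the Jacobi clauses at the odd primes of `m`) and `K` imaginary quadratic of discriminant
`−n₀` with Kronecker character `ε_K`:
`∃ (t : ℤ) (x : ℤ_[p]), (f = 1 → t = 1) ∧ ↑x = k⁻¹ · B_k((χ↑ε_K↑)~) ∧ (H(k, m n₀ f²) : ℚ_p) = −(t · x)`.
So a `q`-series `G` with `coeff a G = ι(y_a)`, `↑y_a = −H(k, a)` (the NEGATED cut Cohen series reduced through `ι : ℤ_[p] →+* 𝔽`)
satisfies `coeff (m n₀ f²) G = t · ι x` — the dictionary of registry v23's `stub_cutForm`, with nothing about modular forms used.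
[cite: Cohen1975, §2 (definition of H(r, N))] [cite: Washington1997, Thm. 5.11 and Cor. 5.13] -/
theorem exists_dictionary_cut {m : ℕ} [NeZero m] {χ : DirichletCharacter ℚ_[p] m} {k n₀ f : ℕ} {K : Type} [Field K]
    [NumberField K] {εK : DirichletCharacter ℚ_[p] (NumberField.discr K).natAbs}
    (hp4 : p % 4 = 3) (h7 : 7 ≤ p) (hmp : m.Coprime p) (hχ : χ.IsPrimitive) (hχq : χ.IsQuadratic)
    (hk : k = (p + 1) / 4 ∨ k = (3 * p - 1) / 4) (hpar : χ (-1) * (-1) ^ k = -1) (hsq : Squarefree n₀) (h4 : n₀ % 4 = 3)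
    (hf : 0 < f) (hJ : ∀ q : ℕ, q.Prime → q ∣ m → q ≠ 2 → jacobiSym (-((n₀ * f ^ 2 : ℕ) : ℤ)) q = 1)
    (hK : IsImaginaryQuadratic K) (hdisc : NumberField.discr K = -(n₀ : ℤ)) (hεK : IsKroneckerCharacterOf K εK) :
    ∃ (t : ℤ) (x : ℤ_[p]), (f = 1 → t = 1) ∧
      (x : ℚ_[p]) = (k : ℚ_[p])⁻¹ * @generalizedBernoulli ℚ_[p] _ _
        (changeLevel (dvd_mul_right m (NumberField.discr K).natAbs) χ *
          changeLevel (dvd_mul_left (NumberField.discr K).natAbs m) εK).conductor ⟨conductor_ne_zero _⟩ k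
        (changeLevel (dvd_mul_right m (NumberField.discr K).natAbs) χ *
          changeLevel (dvd_mul_left (NumberField.discr K).natAbs m) εK).primitiveCharacter ∧
      ((cohenH k (m * (n₀ * f ^ 2)) : ℚ) : ℚ_[p]) = -((t : ℚ_[p]) * (x : ℚ_[p])) := by
  obtain ⟨t, ht1, ht⟩ := exists_int_ratCast_cohenH_cut_eq hχ hχq hpar hsq h4 hf hJ hK hdisc hεK
  obtain ⟨x, hx⟩ := exists_padicInt_bernoulli_cut hp4 h7 hmp hχ hχq hk hK hsq h4 hdisc hεK (coprime_of_cut h4 hJ)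
  refine ⟨t, x, ht1, hx, ?_⟩
  rw [ht, hx, neg_mul]

/-! ## §4 The dictionary clause of `stub_cutForm`, VERBATIM, for any `G` whose cut coefficients reduce `−H(k, ·)` -/

/-- **THE DICTIONARY CLAUSE OF REGISTRY v23/v24's `stub_cutForm` ((CutForm⁶)), VERBATIM SHAPE, DISCHARGED** for every power series `G`
over a field `𝔽` whose coefficient at each cut index `a` is `ι(−y_a)` for some `y_a : ℤ_[p]` lifting `H(k, a)` (`ι : ℤ_[p] →+* 𝔽` any ring
map — in the glue, reduction mod `p`): for all `n₀ f K ε_K` as in the clause,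
`∃ (t : ℤ) (x : ℤ_[p]), (f = 1 → t = 1) ∧ ↑x = k⁻¹ B_k((χ↑ε_K↑)~) ∧ coeff (m n₀ f²) G = t · ι x`.
Class data: `p ≡ 3 (mod 4)`, `p ≥ 7`, `p ∤ m`, `χ` primitive quadratic, `k ∈ {(p+1)/4, (3p−1)/4}`, parity clause. Nothing modular is used;
`G`'s other properties (support, the Katz family) are the glue's business. [cite: Cohen1975, §2 (definition of H(r, N))] -/
theorem cutForm_dictionary_of_coeff {m : ℕ} [NeZero m] {χ : DirichletCharacter ℚ_[p] m} {k : ℕ}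
    (hp4 : p % 4 = 3) (h7 : 7 ≤ p) (hmp : m.Coprime p) (hχ : χ.IsPrimitive) (hχq : χ.IsQuadratic)
    (hk : k = (p + 1) / 4 ∨ k = (3 * p - 1) / 4) (hpar : χ (-1) * (-1) ^ k = -1)
    {𝔽 : Type} [Field 𝔽] (ι : ℤ_[p] →+* 𝔽) (G : PowerSeries 𝔽) {r e : ℕ}
    (hG : ∀ a : ℕ, m ∣ a → a / m % 4 = 3 → (∀ q : ℕ, q.Prime → q ∣ m → q ≠ 2 → jacobiSym (-((a / m : ℕ) : ℤ)) q = 1) →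
      ∃ y : ℤ_[p], (y : ℚ_[p]) = ((cohenH k a : ℚ) : ℚ_[p]) ∧ PowerSeries.coeff a G = ι (-y)) :
    ∀ (n₀ f : ℕ) (K : Type) [Field K] [NumberField K] (εK : DirichletCharacter ℚ_[p] (NumberField.discr K).natAbs),
      Squarefree n₀ → n₀ % 4 = 3 → 0 < f →
      (m ∣ m * (n₀ * f ^ 2) ∧ m * (n₀ * f ^ 2) / m % 4 = 3 ∧
        (∀ q : ℕ, q.Prime → q ∣ m → q ≠ 2 → jacobiSym (-((m * (n₀ * f ^ 2) / m : ℕ) : ℤ)) q = 1) ∧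
        (2 ∣ m → m * (n₀ * f ^ 2) / m % 8 = 7) ∧ r ^ e ∣ m * (n₀ * f ^ 2) / m ∧
        ¬ r ^ (e + 1) ∣ m * (n₀ * f ^ 2) / m) →
      IsImaginaryQuadratic K → NumberField.discr K = -(n₀ : ℤ) → IsKroneckerCharacterOf K εK →
      ∃ (t : ℤ) (x : ℤ_[p]), (f = 1 → t = 1) ∧
        (x : ℚ_[p]) = (k : ℚ_[p])⁻¹ * @generalizedBernoulli ℚ_[p] _ _
          (changeLevel (dvd_mul_right m (NumberField.discr K).natAbs) χ *
            changeLevel (dvd_mul_left (NumberField.discr K).natAbs m) εK).conductor ⟨conductor_ne_zero _⟩ k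
          (changeLevel (dvd_mul_right m (NumberField.discr K).natAbs) χ *
            changeLevel (dvd_mul_left (NumberField.discr K).natAbs m) εK).primitiveCharacter ∧
        PowerSeries.coeff (m * (n₀ * f ^ 2)) G = (t : 𝔽) * ι x := by
  intro n₀ f K _ _ εK hsq h4 hf hcut hK hdisc hεK
  obtain ⟨hma, ha4, hJ, -, -, -⟩ := hcut
  have hdiv : m * (n₀ * f ^ 2) / m = n₀ * f ^ 2 := Nat.mul_div_cancel_left _ (Nat.pos_of_ne_zero (NeZero.ne m))
  obtain ⟨y, hy, hGy⟩ := hG _ hma ha4 hJ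
  rw [hdiv] at hJ
  obtain ⟨t, x, ht1, hx, hH⟩ := exists_dictionary_cut hp4 h7 hmp hχ hχq hk hpar hsq h4 hf hJ hK hdisc hεK
  refine ⟨t, x, ht1, hx, ?_⟩
  have hyx : y = -((t : ℤ_[p]) * x) := by
    apply PadicInt.ext
    rw [hy, hH, PadicInt.coe_neg, PadicInt.coe_mul, PadicInt.coe_intCast]
  rw [hGy, hyx, neg_neg, map_mul, map_intCast]

end Summit.BirchSwinnertonDyer.BirchSwinnertonDyer.Theorems.PrintCFram.CohenCut

end
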